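import Literature.AlgebraicGeometry.Hyperkaehler.K3HilbertType
import Literature.AlgebraicGeometry.HodgeTheory.LefschetzStandardConjectureFacts
import HarnessLib

/-!
# Charles–Markman: the Lefschetz standard conjecture `B` for projective varieties of `K3^[n]`-type — NAMED FACT

Layer `Literature/AlgebraicGeometry/Hyperkaehler`.  CITE record owed by the Hodge-ladder stage-4
scoping (run/shared/lean/pub/hodge-director/STAGE4-ABELIAN-MOTIVIC-TYPE.md §6/§10, side-rung SR-1) and
by the "Not here" list of `HodgeTheory/LefschetzStandardConjectureFacts` ("hyper-Kähler varieties of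
`K3^[n]` type (Charles–Markman 2013) — need carriers (… deformation type) the real-carrier layer does
not have"): the carrier `Hyperkaehler.IsOfK3HilbertType` now exists (file `K3HilbertType`), so the
printed theorem is recorded here on the tree's real carriers, in the same spelling as Lieberman's
theorem for abelian varieties (`Lieberman1968_lefschetzInvolution_algebraic_abelianVariety`).

## Source (read: arXiv text `paper:arxiv-1009.0413`)

F. Charles, E. Markman, *The standard conjectures for holomorphic symplectic varieties deformation
equivalent to Hilbert schemes of K3 surfaces*, Compos. Math. 149 (2013) 481–494 (arXiv:1009.0413):
* §1, Theorem 1.1, verbatim: "The Lefschetz standard conjecture holds for every smooth projective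
  variety of `K3^[n]`-type."  Corollary 1.2: "The standard conjectures hold for any smooth projective
  variety of `K3^[n]`-type."
* §2, Conjecture 2.1 (their statement of `B(X)`, Grothendieck 1969): "Let `X` [be smooth projective of
  dimension `d`] and `ξ` [the cohomology class of a hyperplane section of `X`] be as above. Then for all
  `i ∈ {0, …, d}`, there exists an algebraic cycle `Z` of codimension `i` in the product `X × X` such
  that the correspondence `[Z]_* : H^{2d-i}(X) → Hⁱ(X)` is the inverse of `∪ ξ^{d-i}`."  (§1: "Here we
  work over `ℂ`"; "`H^i(X)` stands for singular cohomology with rational coefficients.")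

## Rendering (tree carriers) and faithfulness

* "smooth projective variety of `K3^[n]`-type": `Motives.IsSmoothProjective (2 * n) X ∧ IsOfK3HilbertType n X`.
* "the Lefschetz standard conjecture holds for `X`": `∀ η, HodgeTheory.StandardConjectureBStar (2 * n) X η`
  — André's `*_L`-form of `B(X)` on the real carriers `H•(X(ℂ); ℂ)` (file `HodgeTheory/MotivatedClasses`):
  for every polarisation class `η` (the predicate is vacuous for other `η`) and all `a + b = 4n`, the
  Lefschetz involution `*_L : Hᵃ → Hᵇ` is induced by an algebraic class on `X × X`.  Charles–Markman's
  Conj. 2.1 asks, for `i ≤ d`, for an algebraic inverse of `L^{d-i} : Hⁱ → H^{2d-i}`, i.e. exactly the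
  degree-`a > d` half of `*_L` (the inverse hard-Lefschetz isomorphisms); the degree-`a ≤ d` half, `*_L = L^{d-a}` (`lefschetzInvolution_apply_of_le`),
  is algebraic outright (the self-intersections of the diagonal with `pr^* η`), so the two forms agree —
  this is the standing identification "`B` ⟺ `*_L` algebraic ⟺ `Λ` algebraic" of that file (André
  1996 Prop. 1.2; Kleiman 1968 §2).  POLARISATIONS: print states `B(X)` for the class `ξ` of a
  hyperplane section; the tree's predicate quantifies over `IsPolarizationClass` (rational,
  divisor-supported, hard Lefschetz), a priori wider; independence of the polarisation is André 1996
  §3.2 Remarque (p. 21) / Kleiman 1968 — Faithfulness note 1 of `LefschetzStandardConjectureFacts`,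
  under which Lieberman's theorem is recorded in the identical spelling `∀ η, StandardConjectureBStar`.
  This file follows that convention symbol for symbol.
* `n`: the theorem is stated for every `n` (`K3^[1]`-type = K3 surfaces, where `B` is Grothendieck's
  theorem for surfaces; `n = 0` is a point).

## What is NOT here

Any proof (Charles–Markman: `B` in degree `2i` from the algebraicity of the Chern classes `κᵢ` of
Markman's universal-sheaf classes, which are deformable to every `K3^[n]`-type variety via Verbitsky's
hyperholomorphic sheaves, §§3–5; odd degrees vanish) — XL in the tree; Corollary 1.2 (the other
standard conjectures), whose real-carrier forms `StandardConjectureA` would follow from `B` by Kleiman.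
-/

noncomputable section

namespace Literature.AlgebraicGeometry.Hyperkaehler

/-- **Charles–Markman 2013, Theorem 1.1: Grothendieck's `B(X)` — the Lefschetz involution `*_L` is
given by an algebraic correspondence — holds for every smooth projective complex variety `X` of
`K3^[n]`-type** (verbatim statement and their formulation 2.1 of `B(X)` in the module docstring).
Rendering: for `X` smooth projective of dimension `2n` over `ℂ` (`Motives.IsSmoothProjective (2 * n) X`)
of `K3^[n]`-type (`IsOfK3HilbertType n X`) and every `η ∈ H²(X(ℂ); ℂ)`, the tree's `*_L`-algebraicity
predicate holds (the body's head symbol) — i.e. for every polarisation class `η` (the predicate is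
vacuous otherwise) and all `a + b = 4n`, André's Lefschetz involution `*_L : Hᵃ(X(ℂ)) → Hᵇ(X(ℂ))` is
induced by an algebraic class on `X × X`.  Print states it for the class of a hyperplane section;
independence of the polarisation is André 1996 §3.2 Remarque / Kleiman 1968 (Faithfulness note 1 of
the file of `HodgeTheory.Lieberman1968_lefschetzInvolution_algebraic_abelianVariety`, the convention
under which Lieberman's theorem for abelian varieties is recorded there in the identical spelling).  A THEOREM in print (status: proved
classically; unproved in the tree). [cite: CharlesMarkman2013, Thm. 1.1 (§1) and statement 2.1 (§2)]
[cite: Andre1996Motifs, Prop. 1.2 (p. 11) and §3.2 Remarque (p. 21)] -/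
def CharlesMarkman2013_lefschetzStandard_K3HilbertType : Prop :=
  ∀ (n : ℕ) ⦃X : Motives.SchemeOver ℂ⦄, Motives.IsSmoothProjective (2 * n) X → IsOfK3HilbertType n X →
    ∀ η : HodgeTheory.complexBetti X 2, HodgeTheory.StandardConjectureBStar (2 * n) X η

/-- Kernel consequence, `K3^[2]`-type spelling: `B` (algebraicity of `*_L`) for smooth projective
fourfolds of `K3^[2]`-type (e.g. the Fano variety of lines of a smooth cubic fourfold, Beauville–Donagi).
[cite: CharlesMarkman2013, Thm. 1.1 (§1)] -/
theorem CharlesMarkman2013_lefschetzStandard_K3HilbertType.of_squareType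
    (h : CharlesMarkman2013_lefschetzStandard_K3HilbertType) {X : Motives.SchemeOver ℂ}
    (hX : Motives.IsSmoothProjective 4 X) (hK : IsOfK3HilbertSquareType X)
    (η : HodgeTheory.complexBetti X 2) : HodgeTheory.StandardConjectureBStar 4 X η :=
  h 2 hX hK η

end Literature.AlgebraicGeometry.Hyperkaehler

end
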